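import Summits.Ventures.PercRepro.C026TwoHubSources

/-!
# STEP 1 of THEOREM B, counted: `n(D,A)` of the two-hub skeleton by hub patterns (p6, gen 22)

The configurations of `H = G.attachTwoHub a b h h'` (edge type `E ⊕ Fin 5`) split by the colours of
the four hub edges `(h–a, h–b, h'–a, h'–b)`; on the fibre of a pattern `q` with the terminal edge
red, `S ↦ S ∘ Sum.inl` is a bijection onto the hub-graph colourings `O` with `Sum.elim O q` in the
filter (`card_fibre`).  With `DA_attach_iff` (C026TwoHubSources) the nine admissible patterns give
mine-3's STEP 1 count (MINE3-G23-card.md, notation `R = c ~_red h`, `B = c ~_blue h`,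
`B'' = h ~_blue h'`, primes for `h'`):

  `n(D,A) = N₁ + 2·#{(R ∨ R') ∧ ¬B'} + 2·#{(R ∨ R') ∧ ¬B} + 2·U + 2·V`

with `N₁ = #{R ∨ R'}`, `U = #{(R ∨ R') ∧ ¬B ∧ ¬B'}`, `V = #{(R ∨ R') ∧ ¬B ∧ ¬B' ∧ ¬B''}`
(`card_DA_attach`): the `(RR,RR)` pattern contributes `N₁`, `(RR,RB)` and `(RR,BR)` contribute
`#{(R ∨ R') ∧ ¬B'}` each, `(RB,RR)` and `(BR,RR)` the primed count, `(RB,RB)` and `(BR,BR)` `U`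
each, `(RB,BR)` and `(BR,RB)` `V` each, and the seven patterns with a `BB` hub contribute nothing.
-/

namespace PercRepro

namespace MultiGraph

open Finset

variable {V E : Type*} {G : MultiGraph V E} {a b h h' c : V}

section Fibres

variable [Fintype E] [DecidableEq E]

/-- **The fibre of a pattern**: on a set `s` of configurations whose terminal edge has the value
`p4`, the configurations with hub pattern `(p0, p1, p2, p3)` are in bijection with the hub-graph
colourings `O` with `Sum.elim O ![p0, p1, p2, p3, p4] ∈ s`, via `S ↦ S ∘ Sum.inl`. -/
theorem card_fibre (p0 p1 p2 p3 p4 : Bool) (s : Finset (Config (E ⊕ Fin 5)))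
    (hs : ∀ S ∈ s, S (Sum.inr 4) = p4) :
    (s.filter fun S : Config (E ⊕ Fin 5) =>
        (S (Sum.inr 0), S (Sum.inr 1), S (Sum.inr 2), S (Sum.inr 3)) = (p0, p1, p2, p3)).card =
      (univ.filter fun O : Config E => Sum.elim O ![p0, p1, p2, p3, p4] ∈ s).card := by
  have key : ∀ S ∈ s,
      (S (Sum.inr 0), S (Sum.inr 1), S (Sum.inr 2), S (Sum.inr 3)) = (p0, p1, p2, p3) →
      Sum.elim (S ∘ Sum.inl) ![p0, p1, p2, p3, p4] = S := by
    intro S hS hq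
    simp only [Prod.mk.injEq] at hq
    obtain ⟨h0, h1, h2, h3⟩ := hq
    have h4 := hs S hS
    funext f
    rcases f with e | i
    · rfl
    · fin_cases i
      · exact h0.symm
      · exact h1.symm
      · exact h2.symm
      · exact h3.symm
      · exact h4.symm
  refine Finset.card_bij' (fun S _ => S ∘ Sum.inl) (fun O _ => Sum.elim O ![p0, p1, p2, p3, p4])
    ?_ ?_ ?_ ?_
  · intro S hS
    simp only [mem_filter, mem_univ, true_and] at hS ⊢
    rw [key S hS.1 hS.2]
    exact hS.1
  · intro O hO
    simp only [mem_filter, mem_univ, true_and] at hO ⊢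
    exact ⟨hO, rfl⟩
  · intro S hS
    simp only [mem_filter] at hS
    exact key S hS.1 hS.2
  · intro O _
    rfl

omit [Fintype E] [DecidableEq E] in
/-- A count splits along the hub patterns (the colours of `h–a, h–b, h'–a, h'–b`). -/
theorem card_eq_sum_patterns (s : Finset (Config (E ⊕ Fin 5))) :
    s.card = ∑ t : Bool × Bool × Bool × Bool, (s.filter fun S : Config (E ⊕ Fin 5) =>
        (S (Sum.inr 0), S (Sum.inr 1), S (Sum.inr 2), S (Sum.inr 3)) = t).card :=
  Finset.card_eq_sum_card_fiberwise (fun _ _ => mem_univ _)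

/-- The sixteen terms of a sum over four Booleans. -/
theorem sum_bool_four (g : Bool × Bool × Bool × Bool → ℕ) :
    ∑ t, g t = g (true, true, true, true) + g (true, true, true, false) +
      g (true, true, false, true) + g (true, true, false, false) +
      g (true, false, true, true) + g (true, false, true, false) +
      g (true, false, false, true) + g (true, false, false, false) +
      g (false, true, true, true) + g (false, true, true, false) +
      g (false, true, false, true) + g (false, true, false, false) +
      g (false, false, true, true) + g (false, false, true, false) +
      g (false, false, false, true) + g (false, false, false, false) := by
  simp only [Fintype.sum_prod_type, Fintype.sum_bool]
  ring

omit [Fintype E] [DecidableEq E] in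
/-- A pattern with the `BB` hub `h` has an empty fibre in a set that forbids it. -/
theorem card_fibre_bb_h (s : Finset (Config (E ⊕ Fin 5)))
    (hs : ∀ S ∈ s, S (Sum.inr 0) = true ∨ S (Sum.inr 1) = true) (p2 p3 : Bool) :
    (s.filter fun S : Config (E ⊕ Fin 5) =>
        (S (Sum.inr 0), S (Sum.inr 1), S (Sum.inr 2), S (Sum.inr 3)) =
          (false, false, p2, p3)).card = 0 := by
  rw [Finset.card_eq_zero, Finset.filter_eq_empty_iff]
  intro S hS hq
  simp only [Prod.mk.injEq] at hq
  rcases hs S hS with h0 | h1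
  · exact Bool.false_ne_true (hq.1.symm.trans h0)
  · exact Bool.false_ne_true (hq.2.1.symm.trans h1)

omit [Fintype E] [DecidableEq E] in
/-- A pattern with the `BB` hub `h'` has an empty fibre in a set that forbids it. -/
theorem card_fibre_bb_h' (s : Finset (Config (E ⊕ Fin 5)))
    (hs : ∀ S ∈ s, S (Sum.inr 2) = true ∨ S (Sum.inr 3) = true) (p0 p1 : Bool) :
    (s.filter fun S : Config (E ⊕ Fin 5) =>
        (S (Sum.inr 0), S (Sum.inr 1), S (Sum.inr 2), S (Sum.inr 3)) =
          (p0, p1, false, false)).card = 0 := by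
  rw [Finset.card_eq_zero, Finset.filter_eq_empty_iff]
  intro S hS hq
  simp only [Prod.mk.injEq] at hq
  rcases hs S hS with h2 | h3
  · exact Bool.false_ne_true (hq.2.2.1.symm.trans h2)
  · exact Bool.false_ne_true (hq.2.2.2.symm.trans h3)

end Fibres

section Count

variable [Fintype E] [DecidableEq E]
variable (hab : a ≠ b) (hca : c ≠ a) (hcb : c ≠ b) (hha : h ≠ a) (hhb : h ≠ b) (hh'a : h' ≠ a)
  (hh'b : h' ≠ b) (hisoa : ∀ e, G.fst e ≠ a ∧ G.snd e ≠ a) (hisob : ∀ e, G.fst e ≠ b ∧ G.snd e ≠ b)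

include hab hca hcb hha hhb hh'a hh'b hisoa hisob in
open Classical in
/-- **STEP 1 of THEOREM B, the source count**:
`n(D,A) = N₁ + 2·#{(R ∨ R') ∧ ¬B'} + 2·#{(R ∨ R') ∧ ¬B} + 2·U + 2·V`. -/
theorem card_DA_attach :
    (univ.filter fun S : Config (E ⊕ Fin 5) =>
        ((G.attachTwoHub a b h h').Conn S c a ∧ (G.attachTwoHub a b h h').Conn S c b) ∧
        (¬ (G.attachTwoHub a b h h').Conn Sᶜ c a ∧ ¬ (G.attachTwoHub a b h h').Conn Sᶜ c b ∧
          ¬ (G.attachTwoHub a b h h').Conn Sᶜ a b)).card =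
      (univ.filter fun O : Config E => G.Conn O c h ∨ G.Conn O c h').card +
      2 * (univ.filter fun O : Config E =>
        (G.Conn O c h ∨ G.Conn O c h') ∧ ¬ G.Conn Oᶜ c h').card +
      2 * (univ.filter fun O : Config E =>
        (G.Conn O c h ∨ G.Conn O c h') ∧ ¬ G.Conn Oᶜ c h).card +
      2 * (univ.filter fun O : Config E =>
        (G.Conn O c h ∨ G.Conn O c h') ∧ ¬ G.Conn Oᶜ c h ∧ ¬ G.Conn Oᶜ c h').card +
      2 * (univ.filter fun O : Config E =>
        (G.Conn O c h ∨ G.Conn O c h') ∧ ¬ G.Conn Oᶜ c h ∧ ¬ G.Conn Oᶜ c h' ∧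
          ¬ G.Conn Oᶜ h h').card := by
  have hiff := DA_attach_iff (G := G) hab hca hcb hha hhb hh'a hh'b hisoa hisob
  set s : Finset (Config (E ⊕ Fin 5)) := univ.filter fun S : Config (E ⊕ Fin 5) =>
    ((G.attachTwoHub a b h h').Conn S c a ∧ (G.attachTwoHub a b h h').Conn S c b) ∧
      (¬ (G.attachTwoHub a b h h').Conn Sᶜ c a ∧ ¬ (G.attachTwoHub a b h h').Conn Sᶜ c b ∧
        ¬ (G.attachTwoHub a b h h').Conn Sᶜ a b) with hs_def
  have hmem : ∀ S, S ∈ s ↔ (S (Sum.inr 4) = true ∧ (S (Sum.inr 0) = true ∨ S (Sum.inr 1) = true) ∧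
      (S (Sum.inr 2) = true ∨ S (Sum.inr 3) = true) ∧
      (G.Conn (S ∘ Sum.inl) c h ∨ G.Conn (S ∘ Sum.inl) c h') ∧
      (S (Sum.inr 0) = false → ¬ G.Conn (S ∘ Sum.inl)ᶜ c h) ∧
      (S (Sum.inr 1) = false → ¬ G.Conn (S ∘ Sum.inl)ᶜ c h) ∧
      (S (Sum.inr 2) = false → ¬ G.Conn (S ∘ Sum.inl)ᶜ c h') ∧
      (S (Sum.inr 3) = false → ¬ G.Conn (S ∘ Sum.inl)ᶜ c h') ∧
      (S (Sum.inr 0) = false → S (Sum.inr 3) = false → ¬ G.Conn (S ∘ Sum.inl)ᶜ h h') ∧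
      (S (Sum.inr 1) = false → S (Sum.inr 2) = false → ¬ G.Conn (S ∘ Sum.inl)ᶜ h h')) := by
    intro S
    rw [hs_def, mem_filter]
    simp only [mem_univ, true_and]
    exact hiff S
  have h4 : ∀ S ∈ s, S (Sum.inr 4) = true := fun S hS => ((hmem S).1 hS).1
  have h01 : ∀ S ∈ s, S (Sum.inr 0) = true ∨ S (Sum.inr 1) = true :=
    fun S hS => ((hmem S).1 hS).2.1
  have h23 : ∀ S ∈ s, S (Sum.inr 2) = true ∨ S (Sum.inr 3) = true :=
    fun S hS => ((hmem S).1 hS).2.2.1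
  rw [card_eq_sum_patterns s, sum_bool_four]
  rw [card_fibre_bb_h s h01, card_fibre_bb_h s h01, card_fibre_bb_h s h01, card_fibre_bb_h s h01,
    card_fibre_bb_h' s h23, card_fibre_bb_h' s h23, card_fibre_bb_h' s h23]
  rw [card_fibre true true true true true s h4, card_fibre true true true false true s h4,
    card_fibre true true false true true s h4, card_fibre true false true true true s h4,
    card_fibre true false true false true s h4, card_fibre true false false true true s h4,
    card_fibre false true true true true s h4, card_fibre false true true false true s h4,
    card_fibre false true false true true s h4]
  simp only [hmem, Sum.elim_inr, Sum.elim_comp_inl, Matrix.cons_val_zero, Matrix.cons_val_one,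
    Matrix.head_cons, Matrix.cons_val_two, Matrix.tail_cons, Matrix.cons_val_three,
    Matrix.cons_val_four, Bool.true_eq_false, Bool.false_eq_true, or_false, or_true, true_and,
    and_true, IsEmpty.forall_iff, forall_const, and_self]
  ring

end Count

end MultiGraph

end PercRepro
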